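import Literature.NumberTheory.EllipticCurves.CasselsTateIsogenyAdjoint
import HarnessLib

/-!
# From a descent by `p`-isogeny plus the Cassels–Tate pairing to `Ш(E/K)[n] = 0` (derived lemma)

Topic `NumberTheory/EllipticCurves`, family `bsd`. A derived ALGEBRAIC consequence of the functorial
(adjoint) form of the Cassels–Tate pairing (`exists_casselsTate_pairing_adjoint`, Milne *ADT* I.6.9 /
6.10(a)), in the shape used by SECOND-DESCENT certificates: for a dual pair of isogenies `φ : E → E'`,
`ψ : E' → E` with `ψ ∘ φ = [n]`,

* `Ш(φ) : Ш(E/K) → Ш(E'/K)` injective (`Ш(E/K)[φ] = 0`, the output of a first descent on the `φ`-side), and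
* a pair of pairings `B` on `Ш(E/K)`, `B'` on `Ш(E'/K)` with `Ш(φ)`, `Ш(ψ)` adjoint (`B' (Ш(φ) a) b =
  B a (Ш(ψ) b)`) such that `B'` restricted to `Ш(E'/K)[ψ] = ker Ш(ψ)` is NON-DEGENERATE
  (the datum a Cassels–Tate pairing computation on the `ψ`-Selmer group delivers when its kernel is
  exactly the Mordell–Weil image: van Beek–Fisher, *Acta Arith.* 185 (2018) §1, "its image is the kernel
  of the Cassels–Tate pairing … This pairing is the lift of the one on `Ш(E'/K)[φ̂]`. Computing the pairing
  allows us to turn a descent by `p`-isogeny into a full `p`-descent"; Fisher, *J. Number Theory* 98 (2003)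
  Thm. 3),

together give `Ш(E/K)[n] = 0`. Proof (three lines): `n • x = 0 ⇒ Ш(ψ)(Ш(φ) x) = n • x = 0`
(`galH1Map_galH1Map_of_comp_eq_nsmul`) so `Ш(φ) x ∈ Ш(E'/K)[ψ]`; for every `z ∈ Ш(E'/K)[ψ]`,
`B' (Ш(φ) x) z = B x (Ш(ψ) z) = B x 0 = 0`, so `Ш(φ) x = 0` by non-degeneracy, and `x = 0` by injectivity.
The purely algebraic core is stated separately (`AddMonoidHom.nsmul_torsion_eq_zero_of_adjoint_pairing`).
Nothing here constructs a pairing; the Cassels–Tate pairing enters only through the hypotheses (as in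
`CasselsTateIsogenyAdjoint`). [cite: vanBeekFisher2018, §1 p. 369] [cite: Fisher2003, Thm. 3]
[cite: MilneADT2006, Ch. I Remark 6.10(a)]
-/

noncomputable section

open scoped Classical

universe u v w

namespace Literature.NumberTheory.EllipticCurves

/-- **Algebraic core.** Abelian groups `A`, `A'`, additive maps `f : A → A'`, `g : A' → A` with
`g ∘ f = n`, bi-additive pairings `B` on `A` and `B'` on `A'` (values in any abelian group) with `f`, `g`
adjoint (`B' (f a) b = B a (g b)`); if `f` is injective and `B'` is non-degenerate on `ker g`, then
`A[n] = 0`. (The abstract form of "first descent on the `φ`-side + Cassels–Tate pairing non-degenerate on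
`Ш(E')[φ̂]` ⇒ `Ш(E)[n] = 0`"; van Beek–Fisher 2018 §1, Fisher 2003 Thm. 3.)
[cite: vanBeekFisher2018, §1 p. 369] [cite: Fisher2003, Thm. 3] -/
theorem _root_.AddMonoidHom.nsmul_torsion_eq_zero_of_adjoint_pairing
    {A : Type u} {A' : Type v} {C : Type w} [AddCommGroup A] [AddCommGroup A'] [AddCommGroup C]
    (f : A →+ A') (g : A' →+ A) {n : ℕ} (hgf : ∀ a, g (f a) = n • a)
    (B : A →+ A →+ C) (B' : A' →+ A' →+ C) (hadj : ∀ a b, B' (f a) b = B a (g b))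
    (hf : ∀ a, f a = 0 → a = 0)
    (hnd : ∀ y, g y = 0 → (∀ z, g z = 0 → B' y z = 0) → y = 0)
    (x : A) (hx : n • x = 0) : x = 0 := by
  apply hf
  apply hnd (f x)
  · rw [hgf, hx]
  · intro z hz
    rw [hadj, hz, map_zero]

open _root_.WeierstrassCurve

variable {K : Type u} [Field K] [NumberField K] {W W' : WeierstrassCurve K}

/-- `Ш(ψ) (Ш(φ) x) = n • x` on `Ш(E/K)` when `ψ ∘ φ = [n]` on points (from
`galH1Map_galH1Map_of_comp_eq_nsmul` on the underlying `H¹` classes). Milne, *ADT*, proof of Lemma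
I.7.1(b). [cite: MilneADT2006, Ch. I Lemma 7.1(b) (proof), p. 96] -/
theorem shaMap_shaMap_of_comp_eq_nsmul (φ : W.Isogeny W') (ψ : W'.Isogeny W) {n : ℕ}
    (h : ∀ P : W.geomPoints, ψ (φ P) = (n : ℤ) • P) (x : W.sha) :
    shaMap ψ.toAddMonoidHom ψ.equivariant ψ.hasLocalPointsMaps_toAddMonoidHom
        (shaMap φ.toAddMonoidHom φ.equivariant φ.hasLocalPointsMaps_toAddMonoidHom x) = n • x := by
  apply Subtype.ext
  simp only [coe_shaMap_apply]
  rw [galH1Map_galH1Map_of_comp_eq_nsmul φ.toAddMonoidHom φ.equivariant ψ.toAddMonoidHom ψ.equivariant h]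
  rfl

/-- **First descent by `φ` + Cassels–Tate pairing non-degenerate on `Ш(E'/K)[φ̂]` ⇒ `Ш(E/K)[n] = 0`**
(`n = deg φ`; for `n = p` prime this is "`Ш(E/K)[p] = 0` by a full `p`-descent assembled from the
`p`-isogeny descent and the Cassels–Tate pairing on the `φ̂`-Selmer group", van Beek–Fisher 2018 §1,
Fisher 2003 Thm. 3). Hypotheses: a dual pair `φ : E → E'`, `ψ : E' → E`, `ψ ∘ φ = [n]`; pairings `B`, `B'`
on `Ш(E/K)`, `Ш(E'/K)` with `Ш(φ)`, `Ш(ψ)` adjoint — the shape provided by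
`exists_casselsTate_pairing_adjoint K` (Milne *ADT* I Rem. 6.10(a)); `Ш(φ)` injective (`Ш(E/K)[φ] = 0`);
`B'` non-degenerate on `ker Ш(ψ) = Ш(E'/K)[ψ]`. Conclusion: every `x ∈ Ш(E/K)` with `n • x = 0` is `0`.
[cite: vanBeekFisher2018, §1 p. 369] [cite: Fisher2003, Thm. 3] -/
theorem sha_nsmul_torsion_eq_zero_of_shaMap_injective_of_pairing_nondegenerate
    (φ : W.Isogeny W') (ψ : W'.Isogeny W) {n : ℕ} (hdual : ∀ P : W.geomPoints, ψ (φ P) = (n : ℤ) • P)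
    {C : Type w} [AddCommGroup C] (B : W.sha →+ W.sha →+ C) (B' : W'.sha →+ W'.sha →+ C)
    (hadj : ∀ a b,
      B' (shaMap φ.toAddMonoidHom φ.equivariant φ.hasLocalPointsMaps_toAddMonoidHom a) b =
        B a (shaMap ψ.toAddMonoidHom ψ.equivariant ψ.hasLocalPointsMaps_toAddMonoidHom b))
    (hφ : ∀ a, shaMap φ.toAddMonoidHom φ.equivariant φ.hasLocalPointsMaps_toAddMonoidHom a = 0 → a = 0)
    (hnd : ∀ y, shaMap ψ.toAddMonoidHom ψ.equivariant ψ.hasLocalPointsMaps_toAddMonoidHom y = 0 →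
      (∀ z, shaMap ψ.toAddMonoidHom ψ.equivariant ψ.hasLocalPointsMaps_toAddMonoidHom z = 0 → B' y z = 0) →
        y = 0)
    (x : W.sha) (hx : (n : ℤ) • x = 0) : x = 0 := by
  have hx' : n • x = 0 := by rwa [← natCast_zsmul]
  exact AddMonoidHom.nsmul_torsion_eq_zero_of_adjoint_pairing _ _
    (shaMap_shaMap_of_comp_eq_nsmul φ ψ hdual) B B' hadj hφ hnd x hx'

/-- **Pairing-free form (Fisher's kernel description).** For a dual pair `φ : E → E'`, `ψ : E' → E`
with `ψ ∘ φ = [n]`: if `Ш(φ)` is injective (`Ш(E/K)[φ] = 0`) and `Ш(E'/K)[ψ] ∩ Ш(φ)(Ш(E/K)) = 0` — the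
latter is exactly what a NON-DEGENERATE Cassels–Tate pairing on the `ψ`-Selmer group certifies, since the
kernel of the pairing restricted to `Ш(E'/K)[ψ]` is `Ш(E'/K)[ψ] ∩ φШ(E/K)` (Fisher, *J. Number Theory* 98
(2003) Thm. 3; van Beek–Fisher 2018 §1) — then `Ш(E/K)[n] = 0`. No pairing and no named fact enter this
form: `n • x = 0 ⇒ Ш(ψ)(Ш(φ) x) = 0 ⇒ Ш(φ) x ∈ Ш(E'/K)[ψ] ∩ im Ш(φ) = 0 ⇒ x = 0`. (This is the READ-binder
shape suggested by reader 2 of cell bsd-litref, 2026-08-27: the engine's verdict is transported to the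
tree without naming a pairing witness.) [cite: Fisher2003, Thm. 3] [cite: vanBeekFisher2018, §1 p. 369] -/
theorem sha_nsmul_torsion_eq_zero_of_shaMap_injective_of_ker_inf_range_eq_bot
    (φ : W.Isogeny W') (ψ : W'.Isogeny W) {n : ℕ} (hdual : ∀ P : W.geomPoints, ψ (φ P) = (n : ℤ) • P)
    (hφ : ∀ a, shaMap φ.toAddMonoidHom φ.equivariant φ.hasLocalPointsMaps_toAddMonoidHom a = 0 → a = 0)
    (hker : ∀ y, shaMap ψ.toAddMonoidHom ψ.equivariant ψ.hasLocalPointsMaps_toAddMonoidHom y = 0 →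
      (∃ a, shaMap φ.toAddMonoidHom φ.equivariant φ.hasLocalPointsMaps_toAddMonoidHom a = y) → y = 0)
    (x : W.sha) (hx : (n : ℤ) • x = 0) : x = 0 := by
  have hx' : n • x = 0 := by rwa [← natCast_zsmul]
  apply hφ
  apply hker _ _ ⟨x, rfl⟩
  rw [shaMap_shaMap_of_comp_eq_nsmul φ ψ hdual, hx']

/-!
## Pairing-free form (the minimal hypothesis)

The non-degeneracy hypothesis above is only USED through its consequence
`ker Ш(ψ) ∩ im Ш(φ) = 0` ("`Ш(E'/K)[φ̂] ∩ φ Ш(E/K) = 0`", the kernel of the Cassels–Tate pairing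
restricted to `Ш(E'/K)[φ̂]` being `Ш(E'/K)[φ̂] ∩ φ Ш(E/K)` — Fisher 2003 Thm. 3, unconditional). The
three results below record (1) the pairing-free algebraic core, (2) that, given `Ш(φ)` injective and
`ψ ∘ φ = [n]`, the condition `ker Ш(ψ) ∩ im Ш(φ) = 0` is EQUIVALENT to `Ш(E/K)[n] = 0`, and (3) that the
adjoint-pairing non-degeneracy hypothesis implies it; so a certificate may display either hypothesis.
[cite: Fisher2003, Thm. 3] [cite: vanBeekFisher2018, §1 p. 369]
-/

/-- **Algebraic core, pairing-free.** `g ∘ f = n`, `f` injective and `ker g ∩ im f = 0` (stated as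
`g (f a) = 0 → f a = 0`) give `A[n] = 0`. [cite: Fisher2003, Thm. 3] -/
theorem _root_.AddMonoidHom.nsmul_torsion_eq_zero_of_ker_inter_range
    {A : Type u} {A' : Type v} [AddCommGroup A] [AddCommGroup A']
    (f : A →+ A') (g : A' →+ A) {n : ℕ} (hgf : ∀ a, g (f a) = n • a)
    (hf : ∀ a, f a = 0 → a = 0) (hker : ∀ a, g (f a) = 0 → f a = 0)
    (x : A) (hx : n • x = 0) : x = 0 := by
  apply hf
  apply hker
  rw [hgf, hx]

/-- With `g ∘ f = n` and `f` injective, `A[n] = 0` is EQUIVALENT to `ker g ∩ im f = 0`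
(the converse direction does not even use injectivity); the abstract form of Fisher 2003 Thm. 3
(kernel of the pairing on `S^(φ̂)` ↔ `φ`-image). [cite: Fisher2003, Thm. 3] -/
theorem _root_.AddMonoidHom.nsmul_torsion_eq_zero_iff_ker_inter_range
    {A : Type u} {A' : Type v} [AddCommGroup A] [AddCommGroup A']
    (f : A →+ A') (g : A' →+ A) {n : ℕ} (hgf : ∀ a, g (f a) = n • a)
    (hf : ∀ a, f a = 0 → a = 0) :
    (∀ x : A, n • x = 0 → x = 0) ↔ (∀ a, g (f a) = 0 → f a = 0) := by
  refine ⟨fun h a ha => ?_, fun hker x hx => AddMonoidHom.nsmul_torsion_eq_zero_of_ker_inter_range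
    f g hgf hf hker x hx⟩
  rw [h a (by rwa [hgf] at ha), map_zero]

/-- Adjoint pairings with `B'` non-degenerate on `ker g` force `ker g ∩ im f = 0`: the pairing
hypothesis of `AddMonoidHom.nsmul_torsion_eq_zero_of_adjoint_pairing` implies the pairing-free one
(adjointness as in Milne *ADT* I Rem. 6.10(a)). [cite: MilneADT2006, Ch. I Remark 6.10(a)]
[cite: Fisher2003, Thm. 3] -/
theorem _root_.AddMonoidHom.ker_inter_range_eq_zero_of_adjoint_pairing
    {A : Type u} {A' : Type v} {C : Type w} [AddCommGroup A] [AddCommGroup A'] [AddCommGroup C]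
    (f : A →+ A') (g : A' →+ A)
    (B : A →+ A →+ C) (B' : A' →+ A' →+ C) (hadj : ∀ a b, B' (f a) b = B a (g b))
    (hnd : ∀ y, g y = 0 → (∀ z, g z = 0 → B' y z = 0) → y = 0)
    (a : A) (ha : g (f a) = 0) : f a = 0 := by
  apply hnd (f a) ha
  intro z hz
  rw [hadj, hz, map_zero]

/-- **First descent by `φ` + `Ш(E'/K)[ψ] ∩ Ш(φ)(Ш(E/K)) = 0` ⇒ `Ш(E/K)[n] = 0`** (pairing-free form of
`sha_nsmul_torsion_eq_zero_of_shaMap_injective_of_pairing_nondegenerate`; the second hypothesis is what a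
Cassels–Tate pairing computation on the `ψ`-Selmer group certifies when the pairing's kernel on
`Ш(E'/K)[ψ]` is trivial — Fisher 2003 Thm. 3: that kernel is `Ш(E'/K)[ψ] ∩ φ Ш(E/K)`).
Hypotheses: `ψ ∘ φ = [n]` on points; `Ш(φ)` injective; every `y = Ш(φ) a` with `Ш(ψ) y = 0` is `0`.
[cite: Fisher2003, Thm. 3] [cite: vanBeekFisher2018, §1 p. 369] -/
theorem sha_nsmul_torsion_eq_zero_of_shaMap_injective_of_ker_inter_range
    (φ : W.Isogeny W') (ψ : W'.Isogeny W) {n : ℕ} (hdual : ∀ P : W.geomPoints, ψ (φ P) = (n : ℤ) • P)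
    (hφ : ∀ a, shaMap φ.toAddMonoidHom φ.equivariant φ.hasLocalPointsMaps_toAddMonoidHom a = 0 → a = 0)
    (hker : ∀ a, shaMap ψ.toAddMonoidHom ψ.equivariant ψ.hasLocalPointsMaps_toAddMonoidHom
        (shaMap φ.toAddMonoidHom φ.equivariant φ.hasLocalPointsMaps_toAddMonoidHom a) = 0 →
      shaMap φ.toAddMonoidHom φ.equivariant φ.hasLocalPointsMaps_toAddMonoidHom a = 0)
    (x : W.sha) (hx : (n : ℤ) • x = 0) : x = 0 := by
  have hx' : n • x = 0 := by rwa [← natCast_zsmul]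
  exact AddMonoidHom.nsmul_torsion_eq_zero_of_ker_inter_range _ _
    (shaMap_shaMap_of_comp_eq_nsmul φ ψ hdual) hφ hker x hx'

/-- Under `ψ ∘ φ = [n]` and `Ш(φ)` injective, `Ш(E/K)[n] = 0` is EQUIVALENT to
`Ш(E'/K)[ψ] ∩ Ш(φ)(Ш(E/K)) = 0`; so the pairing-free hypothesis is the minimal one (Fisher 2003
Thm. 3: the kernel of the Cassels–Tate pairing on `Ш(E'/K)[φ̂]` is exactly this intersection).
[cite: Fisher2003, Thm. 3] [cite: vanBeekFisher2018, §1 p. 369] -/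
theorem sha_nsmul_torsion_eq_zero_iff_ker_inter_range
    (φ : W.Isogeny W') (ψ : W'.Isogeny W) {n : ℕ} (hdual : ∀ P : W.geomPoints, ψ (φ P) = (n : ℤ) • P)
    (hφ : ∀ a, shaMap φ.toAddMonoidHom φ.equivariant φ.hasLocalPointsMaps_toAddMonoidHom a = 0 → a = 0) :
    (∀ x : W.sha, (n : ℤ) • x = 0 → x = 0) ↔
      (∀ a, shaMap ψ.toAddMonoidHom ψ.equivariant ψ.hasLocalPointsMaps_toAddMonoidHom
          (shaMap φ.toAddMonoidHom φ.equivariant φ.hasLocalPointsMaps_toAddMonoidHom a) = 0 →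
        shaMap φ.toAddMonoidHom φ.equivariant φ.hasLocalPointsMaps_toAddMonoidHom a = 0) := by
  rw [← AddMonoidHom.nsmul_torsion_eq_zero_iff_ker_inter_range _ _
    (shaMap_shaMap_of_comp_eq_nsmul φ ψ hdual) hφ]
  simp only [natCast_zsmul]

/-- The displayed pairing hypothesis (`B'` non-degenerate on `Ш(E'/K)[ψ]`, adjoint to `B`) implies the
pairing-free one `Ш(E'/K)[ψ] ∩ Ш(φ)(Ш(E/K)) = 0` (adjointness: Milne *ADT* I Rem. 6.10(a)).
[cite: MilneADT2006, Ch. I Remark 6.10(a)] [cite: Fisher2003, Thm. 3] -/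
theorem shaMap_ker_inter_range_eq_zero_of_pairing_nondegenerate
    (φ : W.Isogeny W') (ψ : W'.Isogeny W)
    {C : Type w} [AddCommGroup C] (B : W.sha →+ W.sha →+ C) (B' : W'.sha →+ W'.sha →+ C)
    (hadj : ∀ a b,
      B' (shaMap φ.toAddMonoidHom φ.equivariant φ.hasLocalPointsMaps_toAddMonoidHom a) b =
        B a (shaMap ψ.toAddMonoidHom ψ.equivariant ψ.hasLocalPointsMaps_toAddMonoidHom b))
    (hnd : ∀ y, shaMap ψ.toAddMonoidHom ψ.equivariant ψ.hasLocalPointsMaps_toAddMonoidHom y = 0 →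
      (∀ z, shaMap ψ.toAddMonoidHom ψ.equivariant ψ.hasLocalPointsMaps_toAddMonoidHom z = 0 → B' y z = 0) →
        y = 0)
    (a : W.sha)
    (ha : shaMap ψ.toAddMonoidHom ψ.equivariant ψ.hasLocalPointsMaps_toAddMonoidHom
        (shaMap φ.toAddMonoidHom φ.equivariant φ.hasLocalPointsMaps_toAddMonoidHom a) = 0) :
    shaMap φ.toAddMonoidHom φ.equivariant φ.hasLocalPointsMaps_toAddMonoidHom a = 0 :=
  AddMonoidHom.ker_inter_range_eq_zero_of_adjoint_pairing _ _ B B' hadj hnd a ha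

end Literature.NumberTheory.EllipticCurves

end
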